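import Summits.KontsevichZagierPeriods.KontsevichZagierPeriods.Theorems.HurwitzMicroSectorsNormalFormPrincipleM2FiveZetaTwo

/-!
# `NormalFormPrinciple` (stmt-KontsevichZagierPeriods-3869), line `SketchIdeator1` — leaf `stub_boxRigidity`,
# dimension two off the product type (`CatalanTwoWays`, half-angle/Möbius/Catalan side): splitting the log monomial `K`

Registered sub-goal `logMonomialInvId_split` of the layer `CatalanTwoWays` (lead file `…M2`). With
`t₈ = √2 − 1 ∈ (0, 1)`, the log monomial `K = [{0 < u < 1, 1 ≤ t ≤ 1/u}, (1/(1+u²))/t]` splits over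
the base as `K ≡ K₁ + K₂`, `K₁` over `(0, t₈)` and `K₂` over `(t₈, 1)` (Kontsevich–Zagier rule (1a)):
the band over `(0,1)` is the union of the two bands over `(0,t₈)`, `(t₈,1)` and of the fibre over
`u = t₈`, a Lebesgue-null hyperplane section (`Measure.pi_hyperplane`). So `[K]` is congruent to its
restriction to `K₁.domain ∪ K₂.domain` (`KZ.IntegralRep.of_sub_of_restrict_mem_relations`), and the
restriction minus `[K₁]` minus `[K₂]` is ONE domain-additivity relation (`KZ.domainAddRel`, the two
pieces being disjoint and carrying the common integrand `(1/(1+u²))/t`).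
References: M. Kontsevich, D. Zagier, *Periods* (2001), §1.2. No new definitions.
-/

noncomputable section

open MeasureTheory Set
open Literature.NumberTheory.Transcendental Literature.NumberTheory.Transcendental.KZ
open Literature.ModelTheory.ExponentialFields (IsSemialgebraic)

namespace Summit.KontsevichZagierPeriods.HurwitzMicroSectors.NormalFormPrinciple.PiBox.M2

/-- **Stub (splitting the base of `K = M_(0,1)(1/(1+u²), 1/u)` at `t₈ = √2 − 1`, rule 1a).** If `K`,
`K₁`, `K₂` are the log-monomial representations `[{u ∈ I, 1 ≤ t ≤ 1/u}, (1/(1+u²))/t]` over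
`I = (0,1)`, `(0,t₈)`, `(t₈,1)` respectively, then `[K] − [K₁] − [K₂] ∈ relations`: `K.domain` is
`K₁.domain ∪ K₂.domain` plus the null fibre `{u = t₈}`, the two pieces are disjoint, and all three
integrands agree with `(1/(1+u²))/t` on their domains. [cite: KontsevichZagier2001, §1.2 rule (1)] -/
theorem logMonomialInvId_split (K K₁ K₂ : IntegralRep 2)
    (hKd : K.domain = KZlog.band {y : Fin 1 → ℝ | 0 < y 0 ∧ y 0 < 1} (fun _ => (1:ℝ)) (fun y => 1 / y 0))
    (hKi : EqOn K.integrand (fun z => (1 / (1 + z 0 ^ 2)) / z 1) K.domain)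
    (hK₁d : K₁.domain = KZlog.band {y : Fin 1 → ℝ | 0 < y 0 ∧ y 0 < Real.sqrt 2 - 1} (fun _ => (1:ℝ))
      (fun y => 1 / y 0))
    (hK₁i : EqOn K₁.integrand (fun z => (1 / (1 + z 0 ^ 2)) / z 1) K₁.domain)
    (hK₂d : K₂.domain = KZlog.band {y : Fin 1 → ℝ | Real.sqrt 2 - 1 < y 0 ∧ y 0 < 1} (fun _ => (1:ℝ))
      (fun y => 1 / y 0))
    (hK₂i : EqOn K₂.integrand (fun z => (1 / (1 + z 0 ^ 2)) / z 1) K₂.domain) :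
    of K - of K₁ - of K₂ ∈ relations := by
  -- `0 < t₈ < 1`
  have ht₈pos : 0 < Real.sqrt 2 - 1 := sub_pos.2 Real.one_lt_sqrt_two
  have ht₈lt : Real.sqrt 2 - 1 < 1 := by linarith [Real.sqrt_two_lt_three_halves]
  -- the union of the two pieces is a semialgebraic subset of `K.domain` with null complement
  have hE : IsSemialgebraic ℚ (K₁.domain ∪ K₂.domain) :=
    K₁.isSemialgebraic_domain.union K₂.isSemialgebraic_domain
  have hEK : K₁.domain ∪ K₂.domain ⊆ K.domain := by
    rw [hKd, hK₁d, hK₂d]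
    rintro z (hz | hz)
    · exact ⟨⟨hz.1.1, hz.1.2.trans ht₈lt⟩, hz.2⟩
    · exact ⟨⟨ht₈pos.trans hz.1.1, hz.1.2⟩, hz.2⟩
  have hnull : volume (K.domain \ (K₁.domain ∪ K₂.domain)) = 0 := by
    refine measure_mono_null (fun z hz => ?_)
      (Measure.pi_hyperplane (fun _ => (volume : Measure ℝ)) 0 (Real.sqrt 2 - 1))
    rw [hKd, hK₁d, hK₂d] at hz
    rcases lt_trichotomy (z 0) (Real.sqrt 2 - 1) with h | h | h
    · exact absurd (Or.inl ⟨⟨hz.1.1.1, h⟩, hz.1.2⟩) hz.2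
    · exact h
    · exact absurd (Or.inr ⟨⟨h, hz.1.1.2⟩, hz.1.2⟩) hz.2
  -- `[K] ≡ [K|_E]` (null fibre), then ONE domain-additivity relation `[K|_E] − [K₁] − [K₂]`
  have e1 : of K - of (K.restrict _ hE hEK) ∈ relations :=
    K.of_sub_of_restrict_mem_relations hE hEK hnull
  have e2 : of (K.restrict _ hE hEK) - of K₁ - of K₂ ∈ relations := by
    refine domainAddRel_subset_relations ⟨2, K.restrict _ hE hEK, K₁, K₂, rfl, ?_, ?_, ?_, rfl⟩
    · rw [show K₁.domain ∩ K₂.domain = ∅ from ?_, measure_empty]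
      rw [hK₁d, hK₂d]
      exact eq_empty_of_forall_notMem fun z hz => lt_irrefl _ (hz.1.1.2.trans hz.2.1.1)
    · exact fun z hz => (hKi (hEK (Or.inl hz))).trans (hK₁i hz).symm
    · exact fun z hz => (hKi (hEK (Or.inr hz))).trans (hK₂i hz).symm
  have e : of K - of K₁ - of K₂ =
      (of K - of (K.restrict _ hE hEK)) + (of (K.restrict _ hE hEK) - of K₁ - of K₂) := by abel
  rw [e]
  exact relations.add_mem e1 e2

end Summit.KontsevichZagierPeriods.HurwitzMicroSectors.NormalFormPrinciple.PiBox.M2
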